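import Summits.NavierStokesRegularity.NavierStokesRegularity.Theorems.PalasekTowerBreakdownHeredityFromTwoRung

/-!
# NavierStokesRegularity — route `PalasekTowerBreakdown`: the child crux `HeredityFromTwo` is VACUOUS
# at the generic levels OR SUMMIT-BEARING

Supports `stmt-NavierStokesRegularity-19250` (`PalasekTowerBreakdown.HeredityFromTwo := HeredityFrom 2`;
skeleton v2 `Cruxes/HeredityFromTwo/Lines/birth.lean`). Cell `ns-blowup`, seat `ns-palasek-19250-p1`
(g0); companion of `Theorems/PalasekTowerBreakdownHeredityFromTwoRung.lean` (§2 there: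
`palasekTowerBreakdown_breakdownR3_of_heredityFromTwo_rungG : HeredityFromTwo → (∃ k₀ ≥ 2, RungG k₀) →
NavierStokesBreakdownR3`). LABEL: E–C typing (KERNEL bookkeeping by classical logic; theorems only, no
definition, no named fact). WHAT THIS IS NOT: not Navier–Stokes evidence — nothing is constructed,
asserted or refuted; the child crux and Clay (C) are OPEN and appear only as hypotheses / disjuncts.

The refuter STAMP on the item (refuter4 g0, 2026-08-26T05:48Z) records «NON-VACUITY NOT ESTABLISHED: S
vacuously TRUE while no registered level-`k` stage (`k ≥ 2`) exists». This file types the exact logical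
position of the child that follows from §2 of the companion:

* `palasekTowerBreakdown_heredityFromTwo_vacuous_or_breakdownR3` — **`HeredityFromTwo → (every
  pinned rigid quiet wide schedule has NO registered stage at ANY level k ≥ 2) ∨ NavierStokesBreakdownR3`**:
  a proof of the child is either a proof of EMPTINESS of its own hypothesis class at the generic levels,
  or (together with the rung it then quantifies over non-vacuously) a proof of Clay (C);
* `palasekTowerBreakdown_heredityFromTwo_iff_vacuous_of_not_breakdownR3` — under `¬ NavierStokesBreakdownR3`
  (the regularity side of the board) the child HOLDS IFF it is vacuous at the generic levels, iff
  `∀ k ≥ 2, ¬ RungG k` (`…_iff_no_rungG_of_not_breakdownR3`);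
* `palasekTowerBreakdown_heredityFromTwo_rungG_two_iff_all` — under the child, `RungG 2 ↔ ∀ K, RungG K`
  and `(∃ k ≥ 2, RungG k) ↔ RungG 2`: non-vacuity of the child at ANY generic level is exactly the
  route's BC5 rung `RungG 2` (= `EpisodeBase ∧ HeredityAtOne` by `rungG_two_of_heredityAtOne`).

Reading (record only, planner's call): a prover can settle 19250 positively only by (a) an NS DYNAMICS
theorem at every generic level (the stubs `AprioriCeiling` / `ReadoutFloors`), or (b) an EMPTINESS
theorem for registered stages at the generic levels (an amplification CAP for forced flows of the
register at `Re_k = N_k^{3/10}`; none in print, refuter4 K62); a refutation needs a registered stage at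
a generic level in a capped class (companion §3–§4). None of the three objects exists in the tree.

References: S. Palasek, arXiv:2605.13827 §4 [cite: Palasek2026ElementaryModel, §4]; C. L. Fefferman,
Clay problem description, (C) [cite: FeffermanClay2006, (C)].
-/

-- `Summit.<Summit>.<Problem>` is the tree's mandated summit-side namespace (CONVENTIONS §2); for this
-- single-conjunct summit the two coincide, so the duplicate is deliberate.
set_option linter.dupNamespace false

noncomputable section

namespace Summit.NavierStokesRegularity.NavierStokesRegularity.Theorems

open Set
open Summit.NavierStokesRegularity.NavierStokesRegularity.Theses
open Summit.NavierStokesRegularity.FluidComputer.PalasekTowerClayBridge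

/-- **The child crux is VACUOUS at the generic levels OR SUMMIT-BEARING**: under `HeredityFromTwo`,
either NO pinned (`Λ = 8`, `θ = 6/5`) rigid quiet schedule on the wide-base rates carries a globally
anchored registered stage at ANY level `k ≥ 2` (the child's hypothesis class is empty — it holds
vacuously), or Clay (C) `NavierStokesBreakdownR3` holds (one such stage climbs the whole ladder,
`palasekTowerBreakdown_breakdownR3_of_heredityFromTwo_rungG`). Classical case split on (C); nothing
asserted. [cite: Palasek2026ElementaryModel, §4] -/
theorem palasekTowerBreakdown_heredityFromTwo_vacuous_or_breakdownR3
    (h : PalasekTowerBreakdown.HeredityFromTwo) :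
    (∀ S : Schedule TowerRates.wide, S.Pins 8 (6 / 5) → S.Rigid → S.Quiet → ∀ k : ℕ, 2 ≤ k →
        IsEmpty (Stage 1 TowerRates.wide S (Margins.routeG TowerRates.wide) k)) ∨
      NavierStokesBreakdownR3 := by
  by_cases hC : NavierStokesBreakdownR3
  · exact Or.inr hC
  · exact Or.inl fun S hP hR hQ k hk => ⟨fun s =>
      hC (palasekTowerBreakdown_breakdownR3_of_heredityFromTwo_rungG h ⟨k, hk, S, hP, hR, hQ, ⟨s⟩⟩)⟩

/-- **On the regularity side of the board the child holds iff it is vacuous**: under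
`¬ NavierStokesBreakdownR3`, `HeredityFromTwo ↔` (no pinned rigid quiet wide schedule has a registered
stage at any level `k ≥ 2`). [cite: Palasek2026ElementaryModel, §4] -/
theorem palasekTowerBreakdown_heredityFromTwo_iff_vacuous_of_not_breakdownR3
    (hC : ¬ NavierStokesBreakdownR3) :
    PalasekTowerBreakdown.HeredityFromTwo ↔
      ∀ S : Schedule TowerRates.wide, S.Pins 8 (6 / 5) → S.Rigid → S.Quiet → ∀ k : ℕ, 2 ≤ k →
        IsEmpty (Stage 1 TowerRates.wide S (Margins.routeG TowerRates.wide) k) :=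
  ⟨fun h => (palasekTowerBreakdown_heredityFromTwo_vacuous_or_breakdownR3 h).resolve_right hC,
    fun hE S hP hR hQ k hk s => ((hE S hP hR hQ k hk).false s).elim⟩

/-- The same in rung vocabulary: under `¬ NavierStokesBreakdownR3`, `HeredityFromTwo ↔ ∀ k ≥ 2, ¬ RungG k`.
[cite: Palasek2026ElementaryModel, §4] -/
theorem palasekTowerBreakdown_heredityFromTwo_iff_no_rungG_of_not_breakdownR3
    (hC : ¬ NavierStokesBreakdownR3) :
    PalasekTowerBreakdown.HeredityFromTwo ↔ ∀ k : ℕ, 2 ≤ k → ¬ RungG k := by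
  rw [palasekTowerBreakdown_heredityFromTwo_iff_vacuous_of_not_breakdownR3 hC]
  constructor
  · rintro hE k hk ⟨S, hP, hR, hQ, ⟨s⟩⟩
    exact (hE S hP hR hQ k hk).false s
  · intro hN S hP hR hQ k hk
    exact ⟨fun s => hN k hk ⟨S, hP, hR, hQ, ⟨s⟩⟩⟩

/-- **Emptiness at the generic levels proves the child (vacuously)** — the one positive route to 19250
that is not an NS dynamics theorem: an amplification cap showing that no registered design reaches
level `2`. No such cap is asserted. [cite: Palasek2026ElementaryModel, §4] -/
theorem palasekTowerBreakdown_heredityFromTwo_of_no_rungG (hN : ∀ k : ℕ, 2 ≤ k → ¬ RungG k) :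
    PalasekTowerBreakdown.HeredityFromTwo :=
  fun S hP hR hQ k hk s => (hN k hk ⟨S, hP, hR, hQ, ⟨s⟩⟩).elim

/-- Since rungs restrict downwards (`RungG.mono`), emptiness at level `2` alone suffices:
`¬ RungG 2 → HeredityFromTwo`. [folklore] -/
theorem palasekTowerBreakdown_heredityFromTwo_of_not_rungG_two (hN : ¬ RungG 2) :
    PalasekTowerBreakdown.HeredityFromTwo :=
  palasekTowerBreakdown_heredityFromTwo_of_no_rungG fun _k hk hK => hN (hK.mono hk)

/-- **Under the child, non-vacuity at ANY generic level is exactly the BC5 rung `RungG 2`**: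
`(∃ k ≥ 2, RungG k) ↔ RungG 2` (down by `RungG.mono`; the child is not even needed for this direction
of bookkeeping, but see the next theorem for «up»). [folklore] -/
theorem palasekTowerBreakdown_exists_rungG_iff_rungG_two :
    (∃ k : ℕ, 2 ≤ k ∧ RungG k) ↔ RungG 2 :=
  ⟨fun ⟨_k, hk, hK⟩ => hK.mono hk, fun h2 => ⟨2, le_rfl, h2⟩⟩

/-- **Under the child, the BC5 rung is every rung**: `HeredityFromTwo → (RungG 2 ↔ ∀ K, RungG K)`.
[cite: Palasek2026ElementaryModel, §4] -/
theorem palasekTowerBreakdown_heredityFromTwo_rungG_two_iff_all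
    (h : PalasekTowerBreakdown.HeredityFromTwo) : RungG 2 ↔ ∀ K : ℕ, RungG K :=
  ⟨fun h2 K => palasekTowerBreakdown_heredityFromTwo_rungG_all h ⟨2, le_rfl, h2⟩ K, fun hK => hK 2⟩

/-- **The dichotomy read against the sibling items**: under `¬ NavierStokesBreakdownR3`, the child
`HeredityFromTwo` and the conjunction `EpisodeBase ∧ HeredityAtOne` of its two siblings (which gives
`RungG 2`, `rungG_two_of_heredityAtOne`) EXCLUDE each other — on the regularity side of the board at
most one of «19250» and «19179 ∧ 19249» is true. (Contrapositive of the route's deciding composition;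
record only.) [cite: FeffermanClay2006, (C)] -/
theorem palasekTowerBreakdown_heredityFromTwo_not_base_and_atOne_of_not_breakdownR3
    (hC : ¬ NavierStokesBreakdownR3) (h : PalasekTowerBreakdown.HeredityFromTwo) :
    ¬ (PalasekTowerBreakdown.EpisodeBase ∧ PalasekTowerBreakdown.HeredityAtOne) := fun hBA =>
  (palasekTowerBreakdown_heredityFromTwo_iff_no_rungG_of_not_breakdownR3 hC).1 h 2 le_rfl
    (rungG_two_of_heredityAtOne hBA.1 hBA.2)

end Summit.NavierStokesRegularity.NavierStokesRegularity.Theorems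

end
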